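import Mathlib.RingTheory.MvPolynomial.Symmetric.FundamentalTheorem
import Mathlib.RingTheory.MvPolynomial.Homogeneous
import HarnessLib

/-!
# The witness of a symmetric polynomial has no larger degree: `deg f ≤ deg f(e_1, …, e_n)`

Topic `Computability/AlgebraicComplexity`; namespace `Literature.Computability.AlgebraicComplexity`.
For `f ∈ R[y_1, …, y_n]` over a commutative ring and `f_Sym = f(e_1, …, e_n)` (`e_k` the elementary
symmetric polynomials in `x_1, …, x_n`, Mathlib's `MvPolynomial.esymm`, numbering of
`MvPolynomial.esymmAlgHom`), `deg f ≤ deg f_Sym` (`totalDegree_le_totalDegree_aeval_esymm`). This is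
the Remark "`d ≤ d_Sym`" after Thm. 4 of M. Bläser, G. Jindal, *On the Complexity of Symmetric
Polynomials*, ITCS 2019, LIPIcs 124, 47:1–47:14 (p. 47:3), used by the proof of the named fact
`BlaserJindal2019_thm4` (`BlaserJindalSymmetricProofs.lean`) to bound the truncation degree by
`deg f_Sym`.

Proof: grade `R[y]` by the weight `w(y^t) = Σ_i (i+1) t_i`; the substitution `y_i ↦ e_{i+1}` maps
the weight-`w` part of `f` to a homogeneous polynomial of degree `w`, hence onto the degree-`w`
homogeneous component of `f_Sym`; for `w` the weight of a monomial of `f` of maximal degree this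
part is nonzero, so its image is nonzero by the fundamental theorem of symmetric polynomials
(Mathlib's `MvPolynomial.esymmAlgHom_injective`), and `w ≥ deg f`. Theorem-only; no definitions,
no named facts. Honest framing: elementary; nothing here bears on VP versus VNP.
-/

noncomputable section

namespace Literature.Computability.AlgebraicComplexity

open MvPolynomial Finset

section Degree

variable {R : Type*} [CommRing R] {n : ℕ}

/-- `e_{i+1}` in `n` variables is homogeneous of degree `i + 1`. [folklore] -/
private theorem isHomogeneous_esymm_fin_succ (k : ℕ) :
    (MvPolynomial.esymm (Fin n) R k).IsHomogeneous k := by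
  classical
  rw [MvPolynomial.esymm_eq_sum_subtype]
  refine IsHomogeneous.sum _ _ _ fun t _ => ?_
  have h := IsHomogeneous.prod (t : Finset (Fin n)) (fun i => (X i : MvPolynomial (Fin n) R))
    (fun _ => 1) fun i _ => isHomogeneous_X R i
  rwa [Finset.sum_const, smul_eq_mul, mul_one, t.2] at h

/-- The image of a monomial `c · y^t` under `y_i ↦ e_{i+1}` is homogeneous of degree
`w(t) = Σ_i (i+1) t_i`. [folklore] -/
private theorem isHomogeneous_aeval_esymm_monomial (t : Fin n →₀ ℕ) (c : R) :
    (aeval (fun i : Fin n => MvPolynomial.esymm (Fin n) R ((i : ℕ) + 1)) (monomial t c)).IsHomogeneous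
      (t.sum fun i k => ((i : ℕ) + 1) * k) := by
  rw [aeval_monomial, algebraMap_eq]
  have hprod : (t.prod fun i k => MvPolynomial.esymm (Fin n) R ((i : ℕ) + 1) ^ k).IsHomogeneous
      (t.sum fun i k => ((i : ℕ) + 1) * k) := by
    unfold Finsupp.prod Finsupp.sum
    exact IsHomogeneous.prod _ _ _ fun i _ => (isHomogeneous_esymm_fin_succ ((i : ℕ) + 1)).pow (t i)
  simpa only [zero_add] using (isHomogeneous_C (Fin n) c).mul hprod

/-- **Degree lemma** (`d ≤ d_Sym` of Bläser–Jindal's Remark after Thm. 4): for every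
`f ∈ R[y_1, …, y_n]` over a commutative ring, `deg f ≤ deg f(e_1, …, e_n)`. Proof: the part of `f`
of weight `w` (`w(y^t) = Σ (i+1) t_i`) maps onto the degree-`w` homogeneous component of `f_Sym`;
for `w` the weight of a monomial of `f` of maximal degree this part is nonzero, hence so is its
image by the fundamental theorem of symmetric polynomials (`MvPolynomial.esymmAlgHom_injective`),
and `w ≥ deg f`. [cite: BlaserJindal2019, Remark after Thm. 4 (p. 47:3)] -/
theorem totalDegree_le_totalDegree_aeval_esymm (f : MvPolynomial (Fin n) R) :
    f.totalDegree ≤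
      (aeval (fun i : Fin n => MvPolynomial.esymm (Fin n) R ((i : ℕ) + 1)) f).totalDegree := by
  classical
  by_cases hf : f = 0
  · simp [hf]
  set E : MvPolynomial (Fin n) R →ₐ[R] MvPolynomial (Fin n) R :=
    aeval (fun i : Fin n => MvPolynomial.esymm (Fin n) R ((i : ℕ) + 1)) with hE
  -- a monomial of maximal degree and its weight
  have hne : f.support.Nonempty := support_nonempty.2 hf
  obtain ⟨t₀, ht₀, hdeg⟩ := Finset.exists_mem_eq_sup f.support hne (fun s => s.sum fun _ e => e)
  set w : (Fin n →₀ ℕ) → ℕ := fun t => t.sum fun i k => ((i : ℕ) + 1) * k with hw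
  set W := w t₀ with hW
  have hdegW : f.totalDegree ≤ W := by
    rw [MvPolynomial.totalDegree, hdeg, hW, hw]
    exact Finset.sum_le_sum fun i _ => by
      simpa using Nat.le_mul_of_pos_left (t₀ i) (Nat.succ_pos i)
  -- the weight-`W` part of `f`
  set Q : MvPolynomial (Fin n) R :=
    ∑ t ∈ f.support.filter (fun t => w t = W), monomial t (coeff t f) with hQ
  have hQne : Q ≠ 0 := by
    intro h0
    have hmem : t₀ ∈ f.support.filter (fun t => w t = W) := Finset.mem_filter.2 ⟨ht₀, rfl⟩
    have hc := congrArg (coeff t₀) h0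
    rw [hQ, coeff_sum, coeff_zero, Finset.sum_eq_single_of_mem t₀ hmem (fun t _ ht => by
      rw [coeff_monomial, if_neg ht]), coeff_monomial, if_pos rfl] at hc
    exact (mem_support_iff.1 ht₀) hc
  -- its image is the degree-`W` homogeneous component of `E f`
  have hcomp : homogeneousComponent W (E f) = E Q := by
    conv_lhs => rw [f.as_sum]
    rw [map_sum, map_sum, hQ, map_sum, Finset.sum_filter]
    refine Finset.sum_congr rfl fun t _ => ?_
    rw [homogeneousComponent_of_mem ((mem_homogeneousSubmodule _ _).2
      (isHomogeneous_aeval_esymm_monomial t (coeff t f)))]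
    by_cases h : w t = W
    · rw [if_pos h, if_pos h.symm]
    · rw [if_neg h, if_neg (Ne.symm h)]
  -- injectivity of `y_i ↦ e_{i+1}` (fundamental theorem of symmetric polynomials)
  have hEQ : E Q ≠ 0 := by
    intro h0
    apply hQne
    have hinj := MvPolynomial.esymmAlgHom_injective (σ := Fin n) R (n := n)
      (by rw [Fintype.card_fin])
    apply hinj
    apply Subtype.ext
    rw [MvPolynomial.esymmAlgHom_apply, MvPolynomial.esymmAlgHom_apply, map_zero, ← hE, h0]
  have hWle : W ≤ (E f).totalDegree := by
    by_contra hlt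
    push Not at hlt
    exact hEQ (hcomp ▸ homogeneousComponent_eq_zero W (E f) hlt)
  exact hdegW.trans hWle

end Degree


end Literature.Computability.AlgebraicComplexity

end
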